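import Summits.NavierStokesRegularity.FluidComputer.HeadStartPulse
import Summits.NavierStokesRegularity.FluidComputer.DampedTransitionViscousFire

/-!
# Tao's delay gate under NON-UNIFORM diagonal damping, part 9 (bp1 gen 20, BLOCK 3): the DAMPED GATE THEOREM and its
# VISCOUS corollaries under the POLYNOMIAL-TYPE amplitude threshold

Companion of `DampedTransition{,Quiet,Window,Viscous,Fire,Douse,Beable,ViscousFire}.lean` (parts 1–8) and of the
head-start pulse chain `HeadStartPulse{Fire,Douse,Beable,}.lean` (cell `pub-fluidc`, seat bp1).
HONEST FRAMING (verbatim): low prior, high value-of-information experiment on Tao's machine paradigm; NOT a claim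
that NS blows up. Five-mode truncation (5.5) of [Tao2016AveragedNS, §5.5]; nothing is proved about Navier–Stokes.

WHAT THIS FILE DOES. `DampedTransition.firingPhase` (part 7) certifies Theorem 5.3 for the retuned member
`Ẋ = delayCircuitWith K M ε X - E(t)·X`, `0 ≤ Eᵢ ≤ η ≤ 1/1000`, from Tao's datum `delayInit`, under the EXPONENTIAL
amplitude threshold `ε ≤ e^{-10M}/K¹⁰⁰` — an artefact of keeping the clock `b` certified small on ALL of `[t_c, 2]`
(`|b| ≤ 5ε` needs `ε·e^{2M·(2 - t_c)}`-type slack). The pulse chain replaces this by the PULSE HYPOTHESIS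
`64·M·ε²·e^{5M(T - t_c)} ≤ K²⁰` run only up to the delivery time `T₀ = t_c + 888 log K/M + 1/K + 300 log K/K`,
after which `a² + b² + c² + d²` is NON-INCREASING under damping (`HeadStart.sumFour_antitoneOn`), so the fired state
persists for free. The pulse hypothesis at `T = T₀` follows from the POLYNOMIAL-TYPE threshold
`ε ≤ e^{-900·M·log K/K}/K²³⁰⁰` (`HeadStart.pulse_eps_facts`) — polynomial `ε ≤ K⁻²³⁰¹` in the linear band
`900·M·log K ≤ K` (`DampedTransition.eps_poly_of_linear`).

THIS FILE = the drop-in versions, SAME CONCLUSIONS AS THE TREE THEOREMS, only `hεle` changed: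
* `DampedTransition.firingPhase_poly_early` — beable already from `t_c + 888 log K/M + 1/K + 300 log K/K`;
* `DampedTransition.firingPhase_poly` — verbatim the statement of `DampedTransition.firingPhase` (window
  `24 log K/M + 20η`, able `200K⁻¹⁰ + 2η`, beable from `t_c + 888 log K/M + 1/√K` with `200K⁻¹⁰ + 4η`) with
  `hεle : ε ≤ exp (-(900 * M * Real.log K / K)) / K ^ 2300`;
* `DampedTransition.firingPhase_polyLinear` — `900·M·log K ≤ K`, `ε ≤ K⁻²³⁰¹`;
* `DampedTransition.firingPhase_visc_poly`, `DampedTransition.firingPhase_visc_output_poly` — the constant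
  non-uniform viscous-rate corollaries of part 8 (`dᵢ ∈ [μ, μ + Δ]`, conjugacy `Z(s) = (1 - μs)⁻¹Y(T_μ(s))`), proofs
  verbatim from part 8 with `firingPhase ↦ firingPhase_poly`.
The datum `delayInit` is the `b₀ = 0` member of the head-start class (`HeadStart.hs_of_delayInit`), so the late
phase is `HeadStart.sum_sq_from`; the early phase is part 3's `DampedTransition.quietPhase` (which keeps the sharper
`20η` window of the tree statement). [cite: Tao2016AveragedNS, Theorem 5.3, §5.5]. No named facts; 0 sorry.
-/

noncomputable section

namespace Summit.NavierStokesRegularity.FluidComputer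

open Real Set Filter Topology
open Literature.Analysis.FluidPDE.Tao2016AveragedNS
open Literature.Analysis.FluidPDE.Tao2016AveragedNS.Thm53 (invSqrt_facts)
open Literature.Analysis.FluidPDE.Tao2016AveragedNS.Thm53With (family_params abs_sub_sqrt_two_le)
open ViscousConjugacy (viscTime viscTime_le_viscTime viscTime_nonneg)

namespace DampedTransition

/-- Linear-band numerics: `900·M·log K ≤ K`, `16 ≤ K` and `ε ≤ K⁻²³⁰¹` give the polynomial-type threshold
`ε ≤ e^{-900·M·log K/K}/K²³⁰⁰` (`e^{-900·M·log K/K} ≥ e^{-1} ≥ 1/K`). -/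
theorem eps_poly_of_linear {K M ε : ℝ} (hK : 16 ≤ K) (hMlin : 900 * M * Real.log K ≤ K)
    (hεle : ε ≤ 1 / K ^ 2301) : ε ≤ exp (-(900 * M * Real.log K / K)) / K ^ 2300 := by
  have hK0 : 0 < K := by linarith
  have hdiv : 900 * M * Real.log K / K ≤ 1 := by rw [div_le_iff₀ hK0]; linarith
  have he1 : K⁻¹ ≤ exp (-(900 * M * Real.log K / K)) := by
    have h3 : exp (1:ℝ) ≤ K := by
      have := Real.exp_one_lt_d9; linarith
    calc K⁻¹ ≤ (exp 1)⁻¹ := by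
          rw [inv_le_inv₀ hK0 (exp_pos 1)]; exact h3
      _ = exp (-1) := by rw [Real.exp_neg]
      _ ≤ exp (-(900 * M * Real.log K / K)) := by rw [exp_le_exp]; linarith
  refine hεle.trans ?_
  rw [show (1 : ℝ) / K ^ 2301 = K⁻¹ / K ^ 2300 by
    rw [pow_succ, one_div, mul_inv, div_eq_mul_inv, mul_comm]]
  exact div_le_div_of_nonneg_right he1 (by positivity)

end DampedTransition

open DampedTransition in
/-- **THE DAMPED GATE THEOREM under the POLYNOMIAL-TYPE amplitude threshold, early-onset form.** As
`DampedTransition.firingPhase_poly` below, with (beable) already on `[t_c + 888 log K/M + 1/K + 300 log K/K, 2]`.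
[cite: Tao2016AveragedNS, Theorem 5.3, §5.5] -/
theorem DampedTransition.firingPhase_poly_early {K M ε η : ℝ} {E X : ℝ → Fin 5 → ℝ}
    (hX : ∀ t ∈ Icc (0:ℝ) 2, HasDerivAt X (delayCircuitWith K M ε (X t) - E t * X t) t)
    (hE : ∀ t ∈ Icc (0:ℝ) 2, ∀ i, 0 ≤ E t i ∧ E t i ≤ η) (h0 : X 0 = delayInit)
    (hK : 2 * 20 ^ 42 * (Nat.factorial 42 : ℝ) + 16 ≤ K) (hML : 3000 * Real.log K ≤ M)
    (hMK : M ≤ K ^ 10) (hε : 0 < ε) (hεle : ε ≤ exp (-(900 * M * Real.log K / K)) / K ^ 2300)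
    (hη : η ≤ 1 / 1000) :
    ∃ tc : ℝ, |tc - Real.sqrt 2| ≤ 24 * Real.log K / M + 20 * η ∧
      (∀ t ∈ Icc 0 tc,
        |X t 0 - 1| ≤ 200 / K ^ 10 + 2 * η ∧ ∀ i : Fin 5, i ≠ 0 → |X t i| ≤ 200 / K ^ 10) ∧
      (∀ t ∈ Icc (tc + 888 * Real.log K / M + 1 / K + 300 * Real.log K / K) 2,
        |X t 4 - 1| ≤ 200 / K ^ 10 + 4 * η ∧ ∀ i : Fin 5, i ≠ 4 → |X t i| ≤ 200 / K ^ 10) := by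
  obtain ⟨hK16, hM0, hML48, hlog2, -, -, -, -, h2M⟩ := family_params hK hML
  obtain ⟨hδ0, hon, hδle⟩ := family_params_damped hK hML
  have hK0 : 0 < K := by linarith
  have hu0' : 0 < K⁻¹ := inv_pos.2 hK0
  have hη0 : 0 ≤ η := (hE 0 ⟨le_rfl, zero_le_two⟩ 0).1.trans (hE 0 ⟨le_rfl, zero_le_two⟩ 0).2
  have hη100 : η ≤ 1 / 100 := hη.trans (by norm_num)
  have hlog0 : 0 ≤ Real.log K := by linarith
  have hL0 : 0 ≤ 300 * Real.log K / K := by positivity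
  have hd0 : 0 ≤ 888 * Real.log K / M := by positivity
  have hKM : exp (-M) ≤ 1 / K ^ 10 := HeadStart.exp_neg_le_inv_pow hK0 (by linarith)
  obtain ⟨hε1, hεK, hε100, hεT⟩ := HeadStart.pulse_eps_facts hK16 hM0 hMK hε hεle
  have hεK6 : ε ^ 2 ≤ 1 / (6 * K ^ 20) :=
    hεK.trans (one_div_le_one_div_of_le (by positivity) (by nlinarith [pow_pos hK0 20]))
  have hs0 := HeadStart.hs_of_delayInit hε.le h0
  obtain ⟨τ, ⟨hlo, hhi, hτ1, hτ32⟩, hcτeq, hwin⟩ :=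
    quietPhase hX hE h0 hε hε1 hM0 hMK hK16 hML48 hεK6 hη100
  have hτ2 : τ ≤ 2 := by linarith
  have hcτ : ∀ t, 0 ≤ t → t ≤ τ → X t 2 ≤ ε ^ 2 / K ^ 10 :=
    fun t h0t htτ => (hwin t ⟨h0t, htτ⟩).1.2
  have hfit2 : τ + 888 * Real.log K / M + K⁻¹ + 300 * Real.log K / K ≤ 2 := by
    have h1 : τ + 888 * Real.log K / M + (sqrt K)⁻¹ ≤ 2 := window_fits_damped hK16 hτ1 hhi h2M hη hδle
    have h2 : K⁻¹ + 300 * Real.log K / K ≤ (sqrt K)⁻¹ :=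
      HeadStart.inv_add_log_le_invSqrt (HeadStart.K0_ge hK)
    linarith
  have hεT' : 64 * M * ε ^ 2 * exp (5 * M * ((τ + 888 * Real.log K / M + K⁻¹ + 300 * Real.log K / K) - τ))
      ≤ K ^ 20 := by
    have : (τ + 888 * Real.log K / M + K⁻¹ + 300 * Real.log K / K) - τ
        = 888 * Real.log K / M + K⁻¹ + 300 * Real.log K / K := by ring
    rw [this]; exact hεT
  refine ⟨τ, ?_, ?_, ?_⟩
  · have hx : 0 ≤ 24 * Real.log K / M + 20 * η := by positivity
    have hyx : 2 / M + 20 * η ≤ 24 * Real.log K / M + 20 * η := by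
      have : 2 / M ≤ 24 * Real.log K / M := div_le_div_of_nonneg_right (by linarith) hM0.le
      linarith
    exact abs_sub_sqrt_two_le hτ1 hx hyx (by linarith) (by linarith)
  · intro t ht
    exact able_window hX hE h0 hε hε1 hM0.le hK16 hεK6 hε100 hτ2 hcτ ht
  · intro t ht
    have ht' : t ∈ Icc (τ + 888 * Real.log K / M + K⁻¹ + 300 * Real.log K / K) 2 := by
      refine ⟨?_, ht.2⟩
      have h1 := ht.1
      rw [one_div] at h1
      linarith
    have ht0 : t ∈ Icc (0:ℝ) 2 := ⟨by linarith [ht'.1], ht.2⟩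
    exact beable_of_sum_sq hX hE h0 hK16 ht0
      (HeadStart.sum_sq_from (T := τ + 888 * Real.log K / M + K⁻¹ + 300 * Real.log K / K) hX hE hs0 hε
        hε1 hM0 hMK hK16 hεK hε100 hKM hη100 hδ0 hon hL0 (HeadStart.drain_numeric hK16) hτ1 le_rfl hfit2
        hεT' hcτ hcτeq ht')

open DampedTransition in
/-- **THE DAMPED GATE THEOREM under the POLYNOMIAL-TYPE amplitude threshold** — the statement of
`DampedTransition.firingPhase` (part 7) VERBATIM except `hεle`: for `K ≥ 2·20⁴²·42! + 16`, `3000 log K ≤ M ≤ K¹⁰`,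
`0 < ε ≤ e^{-900·M·log K/K}/K²³⁰⁰`, ANY diagonal damping `0 ≤ Eᵢ(t) ≤ η ≤ 1/1000` on `[0,2]` and ANY `X` with
`Ẋ = delayCircuitWith K M ε X - E(t) * X` on `[0,2]` from `delayInit`: a critical time `t_c` with
`|t_c - √2| ≤ 24 log K / M + 20η`; (able) on `[0, t_c]` — `|a - 1| ≤ 200K⁻¹⁰ + 2η`, `|b|,|c|,|d|,|ã| ≤ 200K⁻¹⁰`;
(beable) on `[t_c + 888 log K/M + 1/√K, 2]` — `|ã - 1| ≤ 200K⁻¹⁰ + 4η`, `|a|,|b|,|c|,|d| ≤ 200K⁻¹⁰`.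
REMARK (where the exponential went): part 7 used `ε ≤ e^{-10M}/K¹⁰⁰` only to keep `|b| ≤ 5ε` certified up to time
2; here the fire/douse/toke estimates run to the delivery time only (pulse hypothesis from `pulse_eps_facts`) and
`a² + b² + c² + d²` is non-increasing afterwards. HONEST FRAMING: a theorem about a five-mode ODE; low prior, high
value-of-information experiment on Tao's machine paradigm; NOT a claim that NS blows up.
[cite: Tao2016AveragedNS, Theorem 5.3, §5.5] -/
theorem DampedTransition.firingPhase_poly {K M ε η : ℝ} {E X : ℝ → Fin 5 → ℝ}
    (hX : ∀ t ∈ Icc (0:ℝ) 2, HasDerivAt X (delayCircuitWith K M ε (X t) - E t * X t) t)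
    (hE : ∀ t ∈ Icc (0:ℝ) 2, ∀ i, 0 ≤ E t i ∧ E t i ≤ η) (h0 : X 0 = delayInit)
    (hK : 2 * 20 ^ 42 * (Nat.factorial 42 : ℝ) + 16 ≤ K) (hML : 3000 * Real.log K ≤ M)
    (hMK : M ≤ K ^ 10) (hε : 0 < ε) (hεle : ε ≤ exp (-(900 * M * Real.log K / K)) / K ^ 2300)
    (hη : η ≤ 1 / 1000) :
    ∃ tc : ℝ, |tc - Real.sqrt 2| ≤ 24 * Real.log K / M + 20 * η ∧
      (∀ t ∈ Icc 0 tc,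
        |X t 0 - 1| ≤ 200 / K ^ 10 + 2 * η ∧ ∀ i : Fin 5, i ≠ 0 → |X t i| ≤ 200 / K ^ 10) ∧
      (∀ t ∈ Icc (tc + 888 * Real.log K / M + 1 / Real.sqrt K) 2,
        |X t 4 - 1| ≤ 200 / K ^ 10 + 4 * η ∧ ∀ i : Fin 5, i ≠ 4 → |X t i| ≤ 200 / K ^ 10) := by
  obtain ⟨tc, hwin, hable, hbe⟩ := DampedTransition.firingPhase_poly_early hX hE h0 hK hML hMK hε hεle hη
  have hKL : K⁻¹ + 300 * Real.log K / K ≤ (sqrt K)⁻¹ :=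
    HeadStart.inv_add_log_le_invSqrt (HeadStart.K0_ge hK)
  refine ⟨tc, hwin, hable, fun t ht => hbe t ⟨?_, ht.2⟩⟩
  have h1 := ht.1
  rw [one_div] at h1 ⊢
  linarith

open DampedTransition in
/-- **Linear-band corollary**: if moreover `900·M·log K ≤ K`, the plainly polynomial `ε ≤ K⁻²³⁰¹` suffices in
`DampedTransition.firingPhase_poly`. [cite: Tao2016AveragedNS, Theorem 5.3, §5.5] -/
theorem DampedTransition.firingPhase_polyLinear {K M ε η : ℝ} {E X : ℝ → Fin 5 → ℝ}
    (hX : ∀ t ∈ Icc (0:ℝ) 2, HasDerivAt X (delayCircuitWith K M ε (X t) - E t * X t) t)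
    (hE : ∀ t ∈ Icc (0:ℝ) 2, ∀ i, 0 ≤ E t i ∧ E t i ≤ η) (h0 : X 0 = delayInit)
    (hK : 2 * 20 ^ 42 * (Nat.factorial 42 : ℝ) + 16 ≤ K) (hML : 3000 * Real.log K ≤ M)
    (hMK : M ≤ K ^ 10) (hMlin : 900 * M * Real.log K ≤ K) (hε : 0 < ε) (hεle : ε ≤ 1 / K ^ 2301)
    (hη : η ≤ 1 / 1000) :
    ∃ tc : ℝ, |tc - Real.sqrt 2| ≤ 24 * Real.log K / M + 20 * η ∧
      (∀ t ∈ Icc 0 tc,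
        |X t 0 - 1| ≤ 200 / K ^ 10 + 2 * η ∧ ∀ i : Fin 5, i ≠ 0 → |X t i| ≤ 200 / K ^ 10) ∧
      (∀ t ∈ Icc (tc + 888 * Real.log K / M + 1 / Real.sqrt K) 2,
        |X t 4 - 1| ≤ 200 / K ^ 10 + 4 * η ∧ ∀ i : Fin 5, i ≠ 4 → |X t i| ≤ 200 / K ^ 10) := by
  obtain ⟨hK16, -⟩ := family_params hK hML
  exact DampedTransition.firingPhase_poly hX hE h0 hK hML hMK hε (eps_poly_of_linear hK16 hMlin hεle) hη

namespace DampedTransition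

section ViscousGatePoly

variable {K M ε μ Δ : ℝ} {d : Fin 5 → ℝ} {Y : ℝ → Fin 5 → ℝ}

/-- **The viscous gate with constant non-uniform rates (conjugated form), POLYNOMIAL-TYPE amplitude threshold**
(`firingPhase_visc` of part 8 with `ε ≤ e^{-10M}/K¹⁰⁰` replaced by `ε ≤ e^{-900·M·log K/K}/K²³⁰⁰`; proof verbatim
except that it calls `firingPhase_poly`). `0 < μ ≤ 1/4`, `dᵢ ∈ [μ, μ + Δ]`,
`Δ/(1 - 2μ) ≤ 1/1000`; `Y` solves `Ẏ = delayCircuitWith K M ε Y - d * Y` on `[0, T_μ(2)]` from `delayInit`;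
family as in `firingPhase`. Then `Z(s) = (1 - μs)⁻¹Y(T_μ(s))` is a delayed-abrupt-transition gate on `[0,2]`
with `η = Δ/(1 - 2μ)`. [cite: Tao2016AveragedNS, Theorem 5.3, §5.5] -/
theorem firingPhase_visc_poly (hμ : 0 < μ) (hμ4 : μ ≤ 1 / 4) (hd : ∀ i, μ ≤ d i ∧ d i ≤ μ + Δ)
    (hY : ∀ t ∈ Icc 0 (viscTime μ 2), HasDerivAt Y (delayCircuitWith K M ε (Y t) - d * Y t) t)
    (h0 : Y 0 = delayInit)
    (hK : 2 * 20 ^ 42 * (Nat.factorial 42 : ℝ) + 16 ≤ K) (hML : 3000 * Real.log K ≤ M)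
    (hMK : M ≤ K ^ 10) (hε : 0 < ε) (hεle : ε ≤ exp (-(900 * M * Real.log K / K)) / K ^ 2300)
    (hΔ : Δ / (1 - 2 * μ) ≤ 1 / 1000) :
    ∃ tc : ℝ, |tc - Real.sqrt 2| ≤ 24 * Real.log K / M + 20 * (Δ / (1 - 2 * μ)) ∧
      (∀ s ∈ Icc 0 tc,
        |(fun r => (1 - μ * r)⁻¹ • Y (viscTime μ r)) s 0 - 1| ≤ 200 / K ^ 10 + 2 * (Δ / (1 - 2 * μ)) ∧
          ∀ i : Fin 5, i ≠ 0 → |(fun r => (1 - μ * r)⁻¹ • Y (viscTime μ r)) s i| ≤ 200 / K ^ 10) ∧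
      (∀ s ∈ Icc (tc + 888 * Real.log K / M + 1 / Real.sqrt K) 2,
        |(fun r => (1 - μ * r)⁻¹ • Y (viscTime μ r)) s 4 - 1| ≤ 200 / K ^ 10 + 4 * (Δ / (1 - 2 * μ)) ∧
          ∀ i : Fin 5, i ≠ 4 → |(fun r => (1 - μ * r)⁻¹ • Y (viscTime μ r)) s i| ≤ 200 / K ^ 10) := by
  have h2μ : μ * 2 < 1 := by linarith
  have hX : ∀ s ∈ Icc (0:ℝ) 2, HasDerivAt (fun r => (1 - μ * r)⁻¹ • Y (viscTime μ r))
      (delayCircuitWith K M ε ((fun r => (1 - μ * r)⁻¹ • Y (viscTime μ r)) s)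
        - (fun r : ℝ => fun i : Fin 5 => (1 - μ * r)⁻¹ * (d i - μ)) s
          * (fun r => (1 - μ * r)⁻¹ • Y (viscTime μ r)) s) s := by
    intro s hs
    have hμs : μ * s < 1 := by nlinarith [hs.2, hμ]
    have hTs : viscTime μ s ∈ Icc 0 (viscTime μ 2) :=
      ⟨viscTime_nonneg hμ hs.1 hμs, viscTime_le_viscTime hμ hs.2 h2μ⟩
    exact hasDerivAt_conj hμ.ne' hμs (hY _ hTs)
  have hE : ∀ s ∈ Icc (0:ℝ) 2, ∀ i,
      0 ≤ (fun r : ℝ => fun i : Fin 5 => (1 - μ * r)⁻¹ * (d i - μ)) s i ∧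
        (fun r : ℝ => fun i : Fin 5 => (1 - μ * r)⁻¹ * (d i - μ)) s i ≤ Δ / (1 - 2 * μ) :=
    fun s hs i => conjRate_bounds hμ hμ4 hd hs i
  have hZ0 : (fun r => (1 - μ * r)⁻¹ • Y (viscTime μ r)) 0 = delayInit := by rw [conj_zero, h0]
  exact firingPhase_poly hX hE hZ0 hK hML hMK hε hεle hΔ

/-- **The physical output on the fired window, POLYNOMIAL-TYPE amplitude threshold** (`firingPhase_visc_output`
of part 8 under `ε ≤ e^{-900·M·log K/K}/K²³⁰⁰`). Same hypotheses; in ORIGINAL variables, for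
`s ∈ [t_c + 888 log K/M + 1/√K, 2]` (conjugated clock; physical time `T_μ(s) = -log(1 - μs)/μ`):
`|Y₄(T_μ(s)) - (1 - μs)| ≤ (1 - μs)(200K⁻¹⁰ + 4Δ/(1 - 2μ))` and `|Yᵢ(T_μ(s))| ≤ (1 - μs)·200K⁻¹⁰` (`i ≠ 4`):
the gate has fired up to the common viscous attrition `1 - μs = e^{-μT_μ(s)}`.
[cite: Tao2016AveragedNS, Theorem 5.3, §5.5] -/
theorem firingPhase_visc_output_poly (hμ : 0 < μ) (hμ4 : μ ≤ 1 / 4) (hd : ∀ i, μ ≤ d i ∧ d i ≤ μ + Δ)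
    (hY : ∀ t ∈ Icc 0 (viscTime μ 2), HasDerivAt Y (delayCircuitWith K M ε (Y t) - d * Y t) t)
    (h0 : Y 0 = delayInit)
    (hK : 2 * 20 ^ 42 * (Nat.factorial 42 : ℝ) + 16 ≤ K) (hML : 3000 * Real.log K ≤ M)
    (hMK : M ≤ K ^ 10) (hε : 0 < ε) (hεle : ε ≤ exp (-(900 * M * Real.log K / K)) / K ^ 2300)
    (hΔ : Δ / (1 - 2 * μ) ≤ 1 / 1000) :
    ∃ tc : ℝ, |tc - Real.sqrt 2| ≤ 24 * Real.log K / M + 20 * (Δ / (1 - 2 * μ)) ∧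
      ∀ s ∈ Icc (tc + 888 * Real.log K / M + 1 / Real.sqrt K) 2,
        |Y (viscTime μ s) 4 - (1 - μ * s)| ≤ (1 - μ * s) * (200 / K ^ 10 + 4 * (Δ / (1 - 2 * μ))) ∧
          ∀ i : Fin 5, i ≠ 4 → |Y (viscTime μ s) i| ≤ (1 - μ * s) * (200 / K ^ 10) := by
  obtain ⟨tc, htc, -, hlate⟩ := firingPhase_visc_poly hμ hμ4 hd hY h0 hK hML hMK hε hεle hΔ
  refine ⟨tc, htc, fun s hs => ?_⟩
  have hs0 : 0 ≤ s := by
    have hB : (0:ℝ) ≤ 2 * 20 ^ 42 * (Nat.factorial 42 : ℝ) := by positivity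
    have hK0 : 0 < K := by linarith
    have hlog : 0 ≤ Real.log K := Real.log_nonneg (by linarith)
    have hM0 : 0 < M := by
      have : (2:ℝ) ≤ Real.log K := by
        have h16 : (16:ℝ) ≤ K := by linarith
        have := Real.log_le_log (by norm_num) h16
        have h2 : (2:ℝ) ≤ Real.log 16 := by
          rw [show (16:ℝ) = 2 ^ 4 by norm_num, Real.log_pow]
          have := Real.log_two_gt_d9; push_cast; nlinarith
        linarith
      nlinarith
    have h1 : 0 ≤ 888 * Real.log K / M := by positivity
    have h2 : 0 ≤ 1 / Real.sqrt K := by positivity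
    have h3 : 0 ≤ tc := by
      have h14 : (7:ℝ) / 5 < Real.sqrt 2 := Thm53.sqrt_two_gt
      have hx : 24 * Real.log K / M + 20 * (Δ / (1 - 2 * μ)) ≤ 24 * Real.log K / M + 1 := by
        nlinarith
      have hLM : 24 * Real.log K / M ≤ 24 / 3000 := by
        rw [div_le_div_iff₀ hM0 (by norm_num)]; nlinarith
      have := (abs_le.1 htc).1
      linarith
    linarith [hs.1]
  have hμs : μ * s < 1 := by nlinarith [hs.2, hμ]
  have hq0 : 0 < 1 - μ * s := by linarith
  obtain ⟨h4, hi⟩ := hlate s hs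
  have hY4 : ∀ i, Y (viscTime μ s) i = (1 - μ * s) * ((fun r => (1 - μ * r)⁻¹ • Y (viscTime μ r)) s i) := by
    intro i
    have := congrFun (unconj (μ := μ) hμs Y) i
    simpa only [Pi.smul_apply, smul_eq_mul] using this
  refine ⟨?_, fun i hi4 => ?_⟩
  · rw [hY4 4, show (1 - μ * s) * ((fun r => (1 - μ * r)⁻¹ • Y (viscTime μ r)) s 4) - (1 - μ * s)
        = (1 - μ * s) * (((fun r => (1 - μ * r)⁻¹ • Y (viscTime μ r)) s 4) - 1) by ring,
      abs_mul, abs_of_pos hq0]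
    exact mul_le_mul_of_nonneg_left h4 hq0.le
  · rw [hY4 i, abs_mul, abs_of_pos hq0]
    exact mul_le_mul_of_nonneg_left (hi i hi4) hq0.le

end ViscousGatePoly

end DampedTransition

end Summit.NavierStokesRegularity.FluidComputer
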